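import Mathlib
import Summits.MatrixMultiplication.MatrixMultiplication.Theorems.HiddenToeplitzCornersHiddenCornerLemmaRStein

/-!
# Krylov absorption of a column (hidden-corner lemma, crux stmt-MatrixMultiplication-10752)

Support file for crux item `stmt-MatrixMultiplication-10752`
(`Summit.MatrixMultiplication.MatrixMultiplication.Theses.HiddenToeplitzCorners.HiddenCornerLemmaR`),
line `frobenius-dual-short-syzygies`, stub `hclR_column_absorbed` (the Krylov half of the reduction
of the `p = 2` G-const dual law to the three-column conjecture PHI-INJ₃).

`Z` is the lower shift on `Fin N → ℂ` written verbatim as in the crux (`Z i j = [i = j + 1]`), so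
`(Zᵀ)^j *ᵥ e` is the `j`-fold up-shift `m ↦ e (m + j)` (`hclR_shiftT_pow_mulVec`).

* `hclR_phi_krylov_absorb` — if `e d ≠ 0` and `e` vanishes above `d`, then every vector vanishing
  above `d` lies in the Krylov span `span {(Zᵀ)^j *ᵥ e | j}` (downward induction: subtract the
  multiple of the `(d - n)`-fold up-shift of `e` that kills the top entry);
* `hclR_phi_top_column` — a matrix `E` has a column `c` whose Krylov span contains every column
  (a column attaining the largest row index of a nonzero entry; any column if `E = 0`);
* `hclR_phi_three_avoiding` — for `4 ≤ r` and `c : Fin r` there are `b` and an injective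
  `ι : Fin 3 → Fin r` avoiding `b` with `ι 0 = c`;
* `hclR_column_absorbed` — the registered statement: for `4 ≤ r` some column `b` of `E` lies in the
  Krylov span of three other columns `ι 0, ι 1, ι 2`.

All statements are over `ℂ` and `Fin N`, matching the crux binders. [folklore]
-/

set_option linter.dupNamespace false

namespace Summit.MatrixMultiplication.MatrixMultiplication.Theorems

open Matrix BigOperators Finset

/-- Krylov absorption.  If `e d ≠ 0` and `e m = 0` for `m > d`, then for every `n ≤ d + 1`, every
vector `w` with `w m = 0` for `m ≥ n` lies in `span {(Zᵀ)^j *ᵥ e | j : ℕ}`. -/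
theorem hclR_phi_krylov_absorb {N : ℕ} (e : Fin N → ℂ) (d : Fin N) (hd : e d ≠ 0)
    (he : ∀ m : Fin N, (d : ℕ) < m → e m = 0) :
    ∀ n : ℕ, n ≤ (d : ℕ) + 1 → ∀ w : Fin N → ℂ, (∀ m : Fin N, n ≤ (m : ℕ) → w m = 0) →
      w ∈ Submodule.span ℂ (Set.range fun j : ℕ =>
        ((Matrix.of fun i j : Fin N => if (i : ℕ) = (j : ℕ) + 1 then (1 : ℂ) else 0)ᵀ ^ j) *ᵥ e) := by
  intro n
  induction n with
  | zero =>
    intro _ w hw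
    have h0 : w = 0 := funext fun m => hw m (Nat.zero_le _)
    rw [h0]
    exact Submodule.zero_mem _
  | succ n ih =>
    intro hn w hw
    have hnN : n < N := by have := d.2; omega
    -- the `(d - n)`-fold up-shift of `e` has entry `e d` at `n` and vanishes above `n`
    have hs_mem : ((Matrix.of fun i j : Fin N => if (i : ℕ) = (j : ℕ) + 1 then (1 : ℂ) else 0)ᵀ ^
        ((d : ℕ) - n)) *ᵥ e ∈ Submodule.span ℂ (Set.range fun j : ℕ =>
        ((Matrix.of fun i j : Fin N => if (i : ℕ) = (j : ℕ) + 1 then (1 : ℂ) else 0)ᵀ ^ j) *ᵥ e) :=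
      Submodule.subset_span ⟨(d : ℕ) - n, rfl⟩
    have hw' : w - (w ⟨n, hnN⟩ / e d) •
        (((Matrix.of fun i j : Fin N => if (i : ℕ) = (j : ℕ) + 1 then (1 : ℂ) else 0)ᵀ ^
          ((d : ℕ) - n)) *ᵥ e) ∈ Submodule.span ℂ (Set.range fun j : ℕ =>
        ((Matrix.of fun i j : Fin N => if (i : ℕ) = (j : ℕ) + 1 then (1 : ℂ) else 0)ᵀ ^ j) *ᵥ e) := by
      apply ih (by omega)
      intro m hm
      simp only [Pi.sub_apply, Pi.smul_apply, smul_eq_mul, hclR_shiftT_pow_mulVec]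
      rcases Nat.eq_or_lt_of_le hm with h | h
      · -- `m = n`: the top entry is cancelled
        have hlt : (m : ℕ) + ((d : ℕ) - n) < N := by have := d.2; omega
        have hmd : (⟨(m : ℕ) + ((d : ℕ) - n), hlt⟩ : Fin N) = d := Fin.ext (by simp only; omega)
        have hmn : (⟨n, hnN⟩ : Fin N) = m := Fin.ext h
        rw [dif_pos hlt, hmd, hmn, div_mul_cancel₀ _ hd, sub_self]
      · -- `m > n`: both entries vanish
        rw [hw m h]
        by_cases hlt : (m : ℕ) + ((d : ℕ) - n) < N
        · rw [dif_pos hlt, he ⟨(m : ℕ) + ((d : ℕ) - n), hlt⟩ (by show (d : ℕ) < (m : ℕ) + ((d : ℕ) - n); omega)]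
          simp
        · rw [dif_neg hlt]
          simp
    have key : w = (w - (w ⟨n, hnN⟩ / e d) •
        (((Matrix.of fun i j : Fin N => if (i : ℕ) = (j : ℕ) + 1 then (1 : ℂ) else 0)ᵀ ^
          ((d : ℕ) - n)) *ᵥ e)) + (w ⟨n, hnN⟩ / e d) •
        (((Matrix.of fun i j : Fin N => if (i : ℕ) = (j : ℕ) + 1 then (1 : ℂ) else 0)ᵀ ^
          ((d : ℕ) - n)) *ᵥ e) := (sub_add_cancel _ _).symm
    rw [key]
    exact Submodule.add_mem _ hw' (Submodule.smul_mem _ _ hs_mem)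

/-- Every matrix has a column whose Krylov span `span {(Zᵀ)^j *ᵥ (Eᵀ c) | j}` contains all
columns: a column attaining the largest row index of a nonzero entry of `E` (the default column
`c₀` if `E = 0`). -/
theorem hclR_phi_top_column {N r : ℕ} (E : Matrix (Fin N) (Fin r) ℂ) (c₀ : Fin r) :
    ∃ c : Fin r, ∀ b : Fin r, Eᵀ b ∈ Submodule.span ℂ (Set.range fun j : ℕ =>
        ((Matrix.of fun i j : Fin N => if (i : ℕ) = (j : ℕ) + 1 then (1 : ℂ) else 0)ᵀ ^ j) *ᵥ (Eᵀ c)) := by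
  classical
  rcases ((Finset.univ : Finset (Fin N × Fin r)).filter (fun q => E q.1 q.2 ≠ 0)).eq_empty_or_nonempty
    with h0 | hne
  · refine ⟨c₀, fun b => ?_⟩
    have hb : Eᵀ b = 0 := by
      funext n
      by_contra h
      have hmem : (n, b) ∈ (Finset.univ : Finset (Fin N × Fin r)).filter (fun q => E q.1 q.2 ≠ 0) :=
        Finset.mem_filter.mpr ⟨Finset.mem_univ _, h⟩
      rw [h0] at hmem
      simp at hmem
    rw [hb]
    exact Submodule.zero_mem _
  · obtain ⟨⟨d, c⟩, hdc, hmax⟩ := Finset.exists_max_image _ (fun q : Fin N × Fin r => (q.1 : ℕ)) hne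
    refine ⟨c, fun b => ?_⟩
    have hEdc : E d c ≠ 0 := (Finset.mem_filter.mp hdc).2
    have htop : ∀ (b' : Fin r) (m : Fin N), (d : ℕ) < m → E m b' = 0 := by
      intro b' m hm
      by_contra h
      have := hmax (m, b') (Finset.mem_filter.mpr ⟨Finset.mem_univ _, h⟩)
      simp only at this
      omega
    exact hclR_phi_krylov_absorb (Eᵀ c) d hEdc (fun m hm => htop c m hm) ((d : ℕ) + 1) le_rfl (Eᵀ b)
      (fun m hm => htop b m (by omega))

/-- For `4 ≤ r` and `c : Fin r` there are an index `b` and an injective `ι : Fin 3 → Fin r`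
avoiding `b` with `ι 0 = c` (transport `0 ↦ 0,1,2` and `b := 3` along the swap `0 ↔ c`). -/
theorem hclR_phi_three_avoiding {r : ℕ} (hr : 4 ≤ r) (c : Fin r) :
    ∃ (b : Fin r) (ι : Fin 3 → Fin r), Function.Injective ι ∧ (∀ i : Fin 3, ι i ≠ b) ∧ ι 0 = c := by
  refine ⟨Equiv.swap (⟨0, by omega⟩ : Fin r) c ⟨3, by omega⟩,
    fun i => Equiv.swap (⟨0, by omega⟩ : Fin r) c ⟨i.val, by have := i.2; omega⟩, ?_, ?_, ?_⟩
  · intro i j hij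
    have h := congrArg Fin.val ((Equiv.swap (⟨0, by omega⟩ : Fin r) c).injective hij)
    exact Fin.ext h
  · intro i h
    have h' := congrArg Fin.val ((Equiv.swap (⟨0, by omega⟩ : Fin r) c).injective h)
    have := i.2
    simp only at h'
    omega
  · exact Equiv.swap_apply_left _ _

/-- **Stub `hclR_column_absorbed`.**  If `E` has `r ≥ 4` columns then some column `b` lies in the
Krylov span `span {(Zᵀ)^j *ᵥ (Eᵀ (ι i)) | i : Fin 3, j : ℕ}` of three other columns `ι`
(`ι` injective, avoiding `b`): take `ι 0` a column attaining the largest row index `d` of a nonzero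
entry of `E`; every column vanishes above `d`, hence is absorbed by the up-shifts of column `ι 0`
(`hclR_phi_krylov_absorb`). -/
theorem hclR_column_absorbed : ∀ (N r : ℕ) (E : Matrix (Fin N) (Fin r) ℂ), 4 ≤ r →
    ∃ (b : Fin r) (ι : Fin 3 → Fin r), Function.Injective ι ∧ (∀ i : Fin 3, ι i ≠ b) ∧
    (Eᵀ b) ∈ Submodule.span ℂ {w : Fin N → ℂ | ∃ (i : Fin 3) (j : ℕ),
    w = ((Matrix.of fun i j : Fin N => if (i : ℕ) = (j : ℕ) + 1 then (1 : ℂ) else 0)ᵀ ^ j) *ᵥ (Eᵀ (ι i))} := by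
  intro N r E hr
  obtain ⟨c, hc⟩ := hclR_phi_top_column E ⟨0, by omega⟩
  obtain ⟨b, ι, hι, hιb, hι0⟩ := hclR_phi_three_avoiding hr c
  refine ⟨b, ι, hι, hιb, Submodule.span_mono ?_ (hc b)⟩
  rintro _ ⟨j, rfl⟩
  exact ⟨0, j, by rw [hι0]⟩

end Summit.MatrixMultiplication.MatrixMultiplication.Theorems
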